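import Summits.Langlands.Langlands.Theses.PrimitiveResidueReduction
import Summits.Langlands.Langlands.Theorems.LevelOneDyadicResidue

/-! BC3 birth skeleton for `ImprimitiveResidueAutomorphy` (node `PrimitiveResidueReduction`, lens-4 g21).  POST-BIRTH form (writer-1 g6): the restated def has been swapped for the route decl `Summit.Langlands.Langlands.Theses.PrimitiveResidueReduction.ImprimitiveResidueAutomorphy` (same text) and publish as `Cruxes/ImprimitiveResidueAutomorphy/Lines/birth.lean`.
Stubs carry `sorry` (registered); the composition is a REAL proof (= node kernel `imprimitiveResidueAutomorphy_of_line`, through KERNEL III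
`Residue.isResiduallyAutomorphic_of_sharedResidual`: residual automorphy depends on ρ only through τ, and the dial is a property of τ). -/

set_option linter.dupNamespace false

open scoped NumberField
open Filter IsDedekindDomain
open Literature.NumberTheory.GaloisRepresentations Literature.NumberTheory.Automorphic
open Summit.Langlands.Langlands.Theses
open Summit.Langlands.Langlands.Theorems.LevelOneDyadic
open Summit.Langlands.Langlands.Theorems.LevelOneDyadic.Residue

-- SKELETON SHAPE (writer-1 g6 fix for `skeleton.extra-hypothesis`): the composition `imprimitiveResidueAutomorphy_of` (hypotheses = stub statements) is folded into ONE closed theorem `ImprimitiveResidueAutomorphy_proof : <route decl>` whose `have` lines invoke the sorried stubs; proof body unchanged.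
namespace Summit.Langlands.Langlands.Cruxes.ImprimitiveResidueAutomorphy.Birth

-- POST-BIRTH: the cell is the route decl `Summit.Langlands.Langlands.Theses.PrimitiveResidueReduction.ImprimitiveResidueAutomorphy` (stmt id in the ledger); no restatement.

/-- stub FS · Fong–Swan lift at level one (Serre GTM 42 Thm 38; Fong 1961, Swan 1963): a residual representation τ with SOLUBLE image of a 2-adic ρ (a.e. unramified, level one) is the residual representation of a FINITE-SOLUBLE-image, a.e. unramified, level-one 2-adic ρ₀ (im ρ₀ ≅ im τ). Size M (continuity of the lift through a finite quotient; unramified where τ is). Shared verbatim with SOL's registered `stub_fongSwanLift` (g14 line_SOL). -/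
theorem stub_fongSwanLift :
    ∀ (K : Type) [Field K] [NumberField K] (n : ℕ) (ρ : Literature.NumberTheory.GaloisRepresentations.FramedGaloisRep K (PadicAlgCl 2) n) (τ : Field.absoluteGaloisGroup K →* GL (Fin n) (Literature.NumberTheory.GaloisRepresentations.padicAlgClResidueField 2)), ρ.IsResidualRepOf (RingHom.id (Literature.NumberTheory.GaloisRepresentations.padicAlgClResidueField 2)) τ → IsSolvable τ.range → (∀ᶠ v : IsDedekindDomain.HeightOneSpectrum (NumberField.RingOfIntegers K) in cofinite, ρ.IsUnramifiedAt v) → (∀ v : IsDedekindDomain.HeightOneSpectrum (NumberField.RingOfIntegers K), ((2 : ℕ) : NumberField.RingOfIntegers K) ∉ v.asIdeal → ρ.IsUnramifiedAt v) → ∃ ρ₀ : Literature.NumberTheory.GaloisRepresentations.FramedGaloisRep K (PadicAlgCl 2) n, (Set.range (fun g : Field.absoluteGaloisGroup K => ρ₀ g)).Finite ∧ IsSolvable (MonoidHom.range (ρ₀ : Field.absoluteGaloisGroup K →* GL (Fin n) (PadicAlgCl 2))) ∧ ρ₀.IsResidualRepOf (RingHom.id (Literature.NumberTheory.GaloisRepresentations.padicAlgClResidueField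 2)) τ ∧ (∀ᶠ v : IsDedekindDomain.HeightOneSpectrum (NumberField.RingOfIntegers K) in cofinite, ρ₀.IsUnramifiedAt v) ∧ (∀ v : IsDedekindDomain.HeightOneSpectrum (NumberField.RingOfIntegers K), ((2 : ℕ) : NumberField.RingOfIntegers K) ∉ v.asIdeal → ρ₀.IsUnramifiedAt v) := by
  sorry

/-- stub SA_aff · residual automorphy mod 2 of FINITE-SOLUBLE-image level-one 2-adic ρ₀ whose residual representations satisfy SOL's two hypotheses and the dial «no soluble residual τ is accessible, some is IMPRIMITIVE (≥ 2 blocks) — by Galois' theorem induced along a non-normal extension of prime-power degree q^k ≥ 4»: NO print engine (non-normal automorphic induction of degree ≥ 4; partial: Ramakrishnan GO(4) 2002, K. Martin 2004 in rank 4) — DECLARED RESIDUAL, IDEA-NEEDED. The load-bearing stub. -/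
theorem stub_imprimitiveArtinResidualAutomorphy :
    ∀ (K : Type) [Field K] [NumberField K] (n : ℕ) (hcpt : Literature.NumberTheory.Automorphic.isCompact_glFiniteIntegralLevel n K), 0 < n → (∀ m : ℕ, m < n → ∀ (K : Type) [Field K] [NumberField K] (hcpt : Literature.NumberTheory.Automorphic.isCompact_glFiniteIntegralLevel m K), 0 < m → ∀ (ι : PadicAlgCl 2 ≃+* ℂ) (ρ : Literature.NumberTheory.GaloisRepresentations.FramedGaloisRep K (PadicAlgCl 2) m), ρ.toGaloisRep.IsIrreducible → (∃ τ : Field.absoluteGaloisGroup K →* GL (Fin m) (Literature.NumberTheory.GaloisRepresentations.padicAlgClResidueField 2), ρ.IsResidualRepOf (RingHom.id (Literature.NumberTheory.GaloisRepresentations.padicAlgClResidueField 2)) τ ∧ IsSolvable τ.range) → ¬ (∃ τ : Field.absoluteGaloisGroup K →* GL (Fin m) (Literature.NumberTheory.GaloisRepresentations.padicAlgClResidueField 2), ρ.IsResidualRepOf (RingHom.id (Literature.NumberTheory.GaloisRepresentations.padicAlgClResidueField 2)) τ ∧ ∀ g h : Field.absoluteGaloisGroup K, τ g * τ h = τ h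 * τ g) → ((∀ᶠ v : IsDedekindDomain.HeightOneSpectrum (NumberField.RingOfIntegers K) in cofinite, ρ.IsUnramifiedAt v) ∧ ∀ (v : IsDedekindDomain.HeightOneSpectrum (NumberField.RingOfIntegers K)) (hv : ((2 : ℕ) : NumberField.RingOfIntegers K) ∈ v.asIdeal), (Literature.NumberTheory.PAdicHodge.fontainePstAdicCompletion v 2 hv).IsDeRhamFramed (ρ.toLocal v)) → (∀ v : IsDedekindDomain.HeightOneSpectrum (NumberField.RingOfIntegers K), ((2 : ℕ) : NumberField.RingOfIntegers K) ∉ v.asIdeal → ρ.IsUnramifiedAt v) → ∃ π : Literature.NumberTheory.Automorphic.CuspidalAutomorphicRepData m K hcpt, π.1.IsLAlgebraic ∧ ∀ᶠ v : IsDedekindDomain.HeightOneSpectrum (NumberField.RingOfIntegers K) in cofinite, ρ.IsUnramifiedAt v ∧ (∃ α : Multiset ℂ, π.1.HasSatakeParamAt v α) ∧ ∀ α : Multiset ℂ, π.1.HasSatakeParamAt v α → ∃ P Q : Polynomial (Valued.v : Valuation (PadicAlgCl 2) NNReal).valuationSubring, ρ.HasFrobCharpolyAt v (P.map (Valued.v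 : Valuation (PadicAlgCl 2) NNReal).valuationSubring.subtype) ∧ Literature.NumberTheory.Automorphic.arithFrobPolyOfSatake ι v.residueCard 1 α = Q.map (Valued.v : Valuation (PadicAlgCl 2) NNReal).valuationSubring.subtype ∧ P.map (IsLocalRing.residue (Valued.v : Valuation (PadicAlgCl 2) NNReal).valuationSubring) = Q.map (IsLocalRing.residue (Valued.v : Valuation (PadicAlgCl 2) NNReal).valuationSubring)) → ∀ (ι : PadicAlgCl 2 ≃+* ℂ) (ρ₀ : Literature.NumberTheory.GaloisRepresentations.FramedGaloisRep K (PadicAlgCl 2) n), (Set.range (fun g : Field.absoluteGaloisGroup K => ρ₀ g)).Finite → IsSolvable (MonoidHom.range (ρ₀ : Field.absoluteGaloisGroup K →* GL (Fin n) (PadicAlgCl 2))) → (∃ τ : Field.absoluteGaloisGroup K →* GL (Fin n) (Literature.NumberTheory.GaloisRepresentations.padicAlgClResidueField 2), ρ₀.IsResidualRepOf (RingHom.id (Literature.NumberTheory.GaloisRepresentations.padicAlgClResidueField 2)) τ ∧ IsSolvable τ.range ∧ ¬ (¬ (Literature.NumberTheory.GaloisRepresentations.glRepresentation τ).IsIrreducible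 ∨ Group.IsNilpotent τ.range ∨ (∃ V : Fin 3 → Submodule (Literature.NumberTheory.GaloisRepresentations.padicAlgClResidueField 2) (Fin n → Literature.NumberTheory.GaloisRepresentations.padicAlgClResidueField 2), (∀ i : Fin 3, V i ≠ ⊥) ∧ iSupIndep V ∧ iSup V = ⊤ ∧ (∀ (g : Field.absoluteGaloisGroup K) (i : Fin 3), ∃ j : Fin 3, Submodule.map (Literature.NumberTheory.GaloisRepresentations.glRepresentation τ g) (V i) = V j)) ∨ ∃ d : ℕ, 2 ≤ d ∧ (∃ V : Fin d → Submodule (Literature.NumberTheory.GaloisRepresentations.padicAlgClResidueField 2) (Fin n → Literature.NumberTheory.GaloisRepresentations.padicAlgClResidueField 2), ((∀ i : Fin d, V i ≠ ⊥) ∧ iSupIndep V ∧ iSup V = ⊤ ∧ (∀ (g : Field.absoluteGaloisGroup K) (i : Fin d), ∃ j : Fin d, Submodule.map (Literature.NumberTheory.GaloisRepresentations.glRepresentation τ g) (V i) = V j)) ∧ ∀ g : Field.absoluteGaloisGroup K, (∃ i : Fin d, Submodule.map (Literature.NumberTheory.GaloisRepresentations.glRepresentation τ g) (V i) = V i) →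 ∀ i : Fin d, Submodule.map (Literature.NumberTheory.GaloisRepresentations.glRepresentation τ g) (V i) = V i)) ∧ (∃ d : ℕ, 2 ≤ d ∧ (∃ V : Fin d → Submodule (Literature.NumberTheory.GaloisRepresentations.padicAlgClResidueField 2) (Fin n → Literature.NumberTheory.GaloisRepresentations.padicAlgClResidueField 2), (∀ i : Fin d, V i ≠ ⊥) ∧ iSupIndep V ∧ iSup V = ⊤ ∧ (∀ (g : Field.absoluteGaloisGroup K) (i : Fin d), ∃ j : Fin d, Submodule.map (Literature.NumberTheory.GaloisRepresentations.glRepresentation τ g) (V i) = V j)))) → (∀ᶠ v : IsDedekindDomain.HeightOneSpectrum (NumberField.RingOfIntegers K) in cofinite, ρ₀.IsUnramifiedAt v) → (∀ v : IsDedekindDomain.HeightOneSpectrum (NumberField.RingOfIntegers K), ((2 : ℕ) : NumberField.RingOfIntegers K) ∉ v.asIdeal → ρ₀.IsUnramifiedAt v) → ∃ π : Literature.NumberTheory.Automorphic.CuspidalAutomorphicRepData n K hcpt, π.1.IsLAlgebraic ∧ ∀ᶠ v : IsDedekindDomain.HeightOneSpectrum (NumberField.RingOfIntegers K) in cofinite,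 ρ₀.IsUnramifiedAt v ∧ (∃ α : Multiset ℂ, π.1.HasSatakeParamAt v α) ∧ ∀ α : Multiset ℂ, π.1.HasSatakeParamAt v α → ∃ P Q : Polynomial (Valued.v : Valuation (PadicAlgCl 2) NNReal).valuationSubring, ρ₀.HasFrobCharpolyAt v (P.map (Valued.v : Valuation (PadicAlgCl 2) NNReal).valuationSubring.subtype) ∧ Literature.NumberTheory.Automorphic.arithFrobPolyOfSatake ι v.residueCard 1 α = Q.map (Valued.v : Valuation (PadicAlgCl 2) NNReal).valuationSubring.subtype ∧ P.map (IsLocalRing.residue (Valued.v : Valuation (PadicAlgCl 2) NNReal).valuationSubring) = Q.map (IsLocalRing.residue (Valued.v : Valuation (PadicAlgCl 2) NNReal).valuationSubring) := by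
  sorry

/-- COMPOSITION (real proof, no sorry): AFF ⟸ FS ∧ SA_aff. -/
theorem ImprimitiveResidueAutomorphy_proof :
    Summit.Langlands.Langlands.Theses.PrimitiveResidueReduction.ImprimitiveResidueAutomorphy := by
  have hFS : ∀ (K : Type) [Field K] [NumberField K] (n : ℕ) (ρ : Literature.NumberTheory.GaloisRepresentations.FramedGaloisRep K (PadicAlgCl 2) n) (τ : Field.absoluteGaloisGroup K →* GL (Fin n) (Literature.NumberTheory.GaloisRepresentations.padicAlgClResidueField 2)), ρ.IsResidualRepOf (RingHom.id (Literature.NumberTheory.GaloisRepresentations.padicAlgClResidueField 2)) τ → IsSolvable τ.range → (∀ᶠ v : IsDedekindDomain.HeightOneSpectrum (NumberField.RingOfIntegers K) in cofinite, ρ.IsUnramifiedAt v) → (∀ v : IsDedekindDomain.HeightOneSpectrum (NumberField.RingOfIntegers K), ((2 : ℕ) : NumberField.RingOfIntegers K) ∉ v.asIdeal → ρ.IsUnramifiedAt v) → ∃ ρ₀ : Literature.NumberTheory.GaloisRepresentations.FramedGaloisRep K (PadicAlgCl 2) n, (Set.range (fun g : Field.absoluteGaloisGroup K => ρ₀ g)).Finite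 ∧ IsSolvable (MonoidHom.range (ρ₀ : Field.absoluteGaloisGroup K →* GL (Fin n) (PadicAlgCl 2))) ∧ ρ₀.IsResidualRepOf (RingHom.id (Literature.NumberTheory.GaloisRepresentations.padicAlgClResidueField 2)) τ ∧ (∀ᶠ v : IsDedekindDomain.HeightOneSpectrum (NumberField.RingOfIntegers K) in cofinite, ρ₀.IsUnramifiedAt v) ∧ (∀ v : IsDedekindDomain.HeightOneSpectrum (NumberField.RingOfIntegers K), ((2 : ℕ) : NumberField.RingOfIntegers K) ∉ v.asIdeal → ρ₀.IsUnramifiedAt v) := stub_fongSwanLift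
  have hSA : ∀ (K : Type) [Field K] [NumberField K] (n : ℕ) (hcpt : Literature.NumberTheory.Automorphic.isCompact_glFiniteIntegralLevel n K), 0 < n → (∀ m : ℕ, m < n → ∀ (K : Type) [Field K] [NumberField K] (hcpt : Literature.NumberTheory.Automorphic.isCompact_glFiniteIntegralLevel m K), 0 < m → ∀ (ι : PadicAlgCl 2 ≃+* ℂ) (ρ : Literature.NumberTheory.GaloisRepresentations.FramedGaloisRep K (PadicAlgCl 2) m), ρ.toGaloisRep.IsIrreducible → (∃ τ : Field.absoluteGaloisGroup K →* GL (Fin m) (Literature.NumberTheory.GaloisRepresentations.padicAlgClResidueField 2), ρ.IsResidualRepOf (RingHom.id (Literature.NumberTheory.GaloisRepresentations.padicAlgClResidueField 2)) τ ∧ IsSolvable τ.range) → ¬ (∃ τ : Field.absoluteGaloisGroup K →* GL (Fin m) (Literature.NumberTheory.GaloisRepresentations.padicAlgClResidueField 2), ρ.IsResidualRepOf (RingHom.id (Literature.NumberTheory.GaloisRepresentations.padicAlgClResidueField 2)) τ ∧ ∀ g h : Field.absoluteGaloisGroup K, τ g * τ h = τ h * τ g) → ((∀ᶠ v : IsDedekindDomain.HeightOneSpectrum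 (NumberField.RingOfIntegers K) in cofinite, ρ.IsUnramifiedAt v) ∧ ∀ (v : IsDedekindDomain.HeightOneSpectrum (NumberField.RingOfIntegers K)) (hv : ((2 : ℕ) : NumberField.RingOfIntegers K) ∈ v.asIdeal), (Literature.NumberTheory.PAdicHodge.fontainePstAdicCompletion v 2 hv).IsDeRhamFramed (ρ.toLocal v)) → (∀ v : IsDedekindDomain.HeightOneSpectrum (NumberField.RingOfIntegers K), ((2 : ℕ) : NumberField.RingOfIntegers K) ∉ v.asIdeal → ρ.IsUnramifiedAt v) → ∃ π : Literature.NumberTheory.Automorphic.CuspidalAutomorphicRepData m K hcpt, π.1.IsLAlgebraic ∧ ∀ᶠ v : IsDedekindDomain.HeightOneSpectrum (NumberField.RingOfIntegers K) in cofinite, ρ.IsUnramifiedAt v ∧ (∃ α : Multiset ℂ, π.1.HasSatakeParamAt v α) ∧ ∀ α : Multiset ℂ, π.1.HasSatakeParamAt v α → ∃ P Q : Polynomial (Valued.v : Valuation (PadicAlgCl 2) NNReal).valuationSubring, ρ.HasFrobCharpolyAt v (P.map (Valued.v : Valuation (PadicAlgCl 2) NNReal).valuationSubring.subtype) ∧ Literature.NumberTheory.Automorphic.arithFrobPolyOfSatake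 ι v.residueCard 1 α = Q.map (Valued.v : Valuation (PadicAlgCl 2) NNReal).valuationSubring.subtype ∧ P.map (IsLocalRing.residue (Valued.v : Valuation (PadicAlgCl 2) NNReal).valuationSubring) = Q.map (IsLocalRing.residue (Valued.v : Valuation (PadicAlgCl 2) NNReal).valuationSubring)) → ∀ (ι : PadicAlgCl 2 ≃+* ℂ) (ρ₀ : Literature.NumberTheory.GaloisRepresentations.FramedGaloisRep K (PadicAlgCl 2) n), (Set.range (fun g : Field.absoluteGaloisGroup K => ρ₀ g)).Finite → IsSolvable (MonoidHom.range (ρ₀ : Field.absoluteGaloisGroup K →* GL (Fin n) (PadicAlgCl 2))) → (∃ τ : Field.absoluteGaloisGroup K →* GL (Fin n) (Literature.NumberTheory.GaloisRepresentations.padicAlgClResidueField 2), ρ₀.IsResidualRepOf (RingHom.id (Literature.NumberTheory.GaloisRepresentations.padicAlgClResidueField 2)) τ ∧ IsSolvable τ.range ∧ ¬ (¬ (Literature.NumberTheory.GaloisRepresentations.glRepresentation τ).IsIrreducible ∨ Group.IsNilpotent τ.range ∨ (∃ V : Fin 3 → Submodule (Literature.NumberTheory.GaloisRepresentations.padicAlgClResidueField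 2) (Fin n → Literature.NumberTheory.GaloisRepresentations.padicAlgClResidueField 2), (∀ i : Fin 3, V i ≠ ⊥) ∧ iSupIndep V ∧ iSup V = ⊤ ∧ (∀ (g : Field.absoluteGaloisGroup K) (i : Fin 3), ∃ j : Fin 3, Submodule.map (Literature.NumberTheory.GaloisRepresentations.glRepresentation τ g) (V i) = V j)) ∨ ∃ d : ℕ, 2 ≤ d ∧ (∃ V : Fin d → Submodule (Literature.NumberTheory.GaloisRepresentations.padicAlgClResidueField 2) (Fin n → Literature.NumberTheory.GaloisRepresentations.padicAlgClResidueField 2), ((∀ i : Fin d, V i ≠ ⊥) ∧ iSupIndep V ∧ iSup V = ⊤ ∧ (∀ (g : Field.absoluteGaloisGroup K) (i : Fin d), ∃ j : Fin d, Submodule.map (Literature.NumberTheory.GaloisRepresentations.glRepresentation τ g) (V i) = V j)) ∧ ∀ g : Field.absoluteGaloisGroup K, (∃ i : Fin d, Submodule.map (Literature.NumberTheory.GaloisRepresentations.glRepresentation τ g) (V i) = V i) → ∀ i : Fin d, Submodule.map (Literature.NumberTheory.GaloisRepresentations.glRepresentation τ g) (V i) = V i)) ∧ (∃ d : ℕ,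 2 ≤ d ∧ (∃ V : Fin d → Submodule (Literature.NumberTheory.GaloisRepresentations.padicAlgClResidueField 2) (Fin n → Literature.NumberTheory.GaloisRepresentations.padicAlgClResidueField 2), (∀ i : Fin d, V i ≠ ⊥) ∧ iSupIndep V ∧ iSup V = ⊤ ∧ (∀ (g : Field.absoluteGaloisGroup K) (i : Fin d), ∃ j : Fin d, Submodule.map (Literature.NumberTheory.GaloisRepresentations.glRepresentation τ g) (V i) = V j)))) → (∀ᶠ v : IsDedekindDomain.HeightOneSpectrum (NumberField.RingOfIntegers K) in cofinite, ρ₀.IsUnramifiedAt v) → (∀ v : IsDedekindDomain.HeightOneSpectrum (NumberField.RingOfIntegers K), ((2 : ℕ) : NumberField.RingOfIntegers K) ∉ v.asIdeal → ρ₀.IsUnramifiedAt v) → ∃ π : Literature.NumberTheory.Automorphic.CuspidalAutomorphicRepData n K hcpt, π.1.IsLAlgebraic ∧ ∀ᶠ v : IsDedekindDomain.HeightOneSpectrum (NumberField.RingOfIntegers K) in cofinite, ρ₀.IsUnramifiedAt v ∧ (∃ α : Multiset ℂ, π.1.HasSatakeParamAt v α) ∧ ∀ α : Multiset ℂ, π.1.HasSatakeParamAt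 v α → ∃ P Q : Polynomial (Valued.v : Valuation (PadicAlgCl 2) NNReal).valuationSubring, ρ₀.HasFrobCharpolyAt v (P.map (Valued.v : Valuation (PadicAlgCl 2) NNReal).valuationSubring.subtype) ∧ Literature.NumberTheory.Automorphic.arithFrobPolyOfSatake ι v.residueCard 1 α = Q.map (Valued.v : Valuation (PadicAlgCl 2) NNReal).valuationSubring.subtype ∧ P.map (IsLocalRing.residue (Valued.v : Valuation (PadicAlgCl 2) NNReal).valuationSubring) = Q.map (IsLocalRing.residue (Valued.v : Valuation (PadicAlgCl 2) NNReal).valuationSubring) := stub_imprimitiveArtinResidualAutomorphy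
  intro K _ _ n hcpt hn ih ι ρ hirr _ _ haff hgeo hlvl
  obtain ⟨hnacc, τ, hτ, hsolv, hI⟩ := haff
  have hP : ¬ (¬ (Literature.NumberTheory.GaloisRepresentations.glRepresentation τ).IsIrreducible ∨ Group.IsNilpotent τ.range ∨ (∃ V : Fin 3 → Submodule (Literature.NumberTheory.GaloisRepresentations.padicAlgClResidueField 2) (Fin n → Literature.NumberTheory.GaloisRepresentations.padicAlgClResidueField 2), (∀ i : Fin 3, V i ≠ ⊥) ∧ iSupIndep V ∧ iSup V = ⊤ ∧ (∀ (g : Field.absoluteGaloisGroup K) (i : Fin 3), ∃ j : Fin 3, Submodule.map (Literature.NumberTheory.GaloisRepresentations.glRepresentation τ g) (V i) = V j)) ∨ ∃ d : ℕ, 2 ≤ d ∧ (∃ V : Fin d → Submodule (Literature.NumberTheory.GaloisRepresentations.padicAlgClResidueField 2) (Fin n → Literature.NumberTheory.GaloisRepresentations.padicAlgClResidueField 2), ((∀ i : Fin d, V i ≠ ⊥) ∧ iSupIndep V ∧ iSup V = ⊤ ∧ (∀ (g : Field.absoluteGaloisGroup K) (i : Fin d), ∃ j : Fin d, Submodule.map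 (Literature.NumberTheory.GaloisRepresentations.glRepresentation τ g) (V i) = V j)) ∧ ∀ g : Field.absoluteGaloisGroup K, (∃ i : Fin d, Submodule.map (Literature.NumberTheory.GaloisRepresentations.glRepresentation τ g) (V i) = V i) → ∀ i : Fin d, Submodule.map (Literature.NumberTheory.GaloisRepresentations.glRepresentation τ g) (V i) = V i)) := fun hP => hnacc ⟨τ, hτ, hsolv, hP⟩
  obtain ⟨ρ₀, hfin, hsol₀, hτ₀, hur₀, hlvl₀⟩ := hFS K n ρ τ hτ hsolv hgeo.1 hlvl
  exact isResiduallyAutomorphic_of_sharedResidual hτ hτ₀ hgeo.1 (hSA K n hcpt hn ih ι ρ₀ hfin hsol₀ ⟨τ, hτ₀, hsolv, hP, hI⟩ hur₀ hlvl₀)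

end Summit.Langlands.Langlands.Cruxes.ImprimitiveResidueAutomorphy.Birth
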